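import Summits.CriticalPhenomena.CardyFormulaZ2.Theorems.CardyRotToConfR2SymmetryUpgrade.Negative.SurgFatFamily
import Summits.CriticalPhenomena.CardyFormulaZ2.Theorems.CardyRotToConfR2SymmetryUpgrade.Negative.SurgConcatSplit
import Summits.CriticalPhenomena.CardyFormulaZ2.Theorems.CardyRotToConfR2SymmetryUpgrade.Negative.SurgStopAtMeasurable
import Summits.CriticalPhenomena.CardyFormulaZ2.Theorems.CardyRotToConfR2SymmetryUpgrade.Negative.TargetIndependence
import Literature.Probability.RandomPlanarGeometry.ThreeMarkedOfPoints
import HarnessLib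

/-!
# The fat-germ one-shot surgery of an admissible chordal family is target independent
# (stub `stub_fatSurgeryTI`, line `germ-label-transport`, crux `stmt-CriticalPhenomena-0698`)

For an admissible family `S` (`IsLocalMarkovChordalFamily S`), the fat surgery
`J := Negative.fatSurgery S` (`SurgFatFamily`) satisfies the splitting form of locality
(`ChordalFamily.IsTargetIndependent`): in a `3`-marked domain `(D; a, b, b')` the `J`-curve to `b`
(`J (D.chord 0 1)`) and the `J`-curve to `b'` (`J (D.chord 0 2)`), both stopped on the closed arc
`A = [b, b'] = D.arc 1`, have the same law.

Proof. `D.chord 0 1` and `D.chord 0 2` have the same carrier and the same start point `a`, hence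
fire together, with the same chord `C` from `a` to the same landing point `q ∈ ∂D`
(`fireChord_congr`, `firePt_congr`).
* Not firing: both laws are those of `S`; use `S`'s own target independence.
* Firing, `q ∈ A`: the chord meets `∂D ⊇ A` only at its endpoints and `a ∉ A`, so its hitting
  parameter of `A` is `1` (`hitParam_fireChord_eq_one`); whether the law is the Dirac mass at `C`
  (`q` = target) or the chord prefixed to an `S`-curve started at `q ∈ A`
  (`stopAt_concat_of_hit`), the stopped class is a.s. `mk C`, so both sides equal `[mk C ∈ T]`
  (`fatSurgery_preimage_stopAt_of_mem`).
* Firing, `q ∉ A` (so `q ≠ b, b'`): both laws are push-forwards of `S` on the crosscut domains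
  `E_b = fireDom (target b)`, `E_b' = fireDom (target b')` along the prefixing map `π`. The chord
  avoids `A`, so stopping commutes with prefixing (`stopAt_concat_of_forall_notMem`) and
  `J Dᵢ (stopAt A ⁻¹' T) = S Eᵢ (stopAt A ⁻¹' (π ⁻¹' T))` (`fatSurgery_preimage_stopAt_of_notMem`).
  The connected arc `A ⊆ ∂D ∖ {a, q}` lies in the boundary arc of `∂D` through `b` cut off by the
  crosscut (`arc_one_subset_bArc`), so `b'` is adjacent to the `b`-component and the two crosscut
  domains have the SAME carrier `E` (`carrier_fireDom_chord_eq`). Re-basing the boundary loop of `E`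
  at `q` gives a `3`-marked structure `(E; q, b, b')` (or `(E; q, b', b)`;
  `JordanDomain.exists_markedThree`, `ThreeMarkedOfPoints`) whose arc `[pt 1, pt 2]` IS `A`
  (`MarkedDomain.arc_one_eq_of_mark_zero`: a sub-arc of the Jordan curve `∂E` is determined by its
  endpoints and a missed point). Target independence of `S` on this structure, transported to
  `E_b`, `E_b'` by restriction locality (`eq_of_isLocal_of_carrier_eq`: the law depends only on
  carrier and marked points), is the claim.

References: G. Lawler, O. Schramm, W. Werner, *Values of Brownian intersection exponents I*,
Acta Math. 187 (2001), Cor. 2.3; W. Werner, *Lectures on two-dimensional critical percolation*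
(2007), §3.2 and Prop. 3.4.
-/

noncomputable section

open Set Filter Topology Metric MeasureTheory
open scoped unitInterval ENNReal

namespace Summit.CriticalPhenomena.CardyFormulaZ2.Theorems.CardyRotToConfR2SymmetryUpgrade

open Literature.Probability.RandomPlanarGeometry Literature.Probability.RandomPlanarGeometry.ChordalFamily
open Literature.Probability.RandomPlanarGeometry.BrownianLoop
open Summit.CriticalPhenomena.CardyFormulaZ2.Theorems.CardyRotToConfR2SymmetryUpgrade.Negative

namespace FatSurgeryTI

/-! ### Stopped laws that are almost surely constant -/

/-- If the stopped class is a.s. the constant `c`, the stopped law is the Dirac mass at `c`.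
[folklore] -/
theorem measure_preimage_stopAt_of_ae_eq {μ : Measure (CurveClass ℂ)} [IsProbabilityMeasure μ]
    {F : Set ℂ} {c : CurveClass ℂ} (h : ∀ᵐ γ ∂μ, CurveClass.stopAt F γ = c)
    (T : Set (CurveClass ℂ)) : μ (CurveClass.stopAt F ⁻¹' T) = T.indicator 1 c := by
  have hae : (CurveClass.stopAt F ⁻¹' T : Set (CurveClass ℂ)) =ᵐ[μ]
      ({_γ | c ∈ T} : Set (CurveClass ℂ)) := by
    refine Filter.eventuallyEq_set.2 ?_
    filter_upwards [h] with γ hγ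
    rw [mem_preimage, hγ]
  rw [measure_congr hae]
  by_cases hc : c ∈ T
  · rw [Set.indicator_of_mem hc, Pi.one_apply]
    have : ({_γ | c ∈ T} : Set (CurveClass ℂ)) = univ := eq_univ_of_forall fun _ => hc
    rw [this, measure_univ]
  · rw [Set.indicator_of_notMem hc]
    have : ({_γ | c ∈ T} : Set (CurveClass ℂ)) = ∅ := eq_empty_of_forall_notMem fun _ h => hc h
    rw [this, measure_empty]

/-! ### The chord against a boundary set missing `a` -/

section Chord

variable {S : ChordalFamily} {D : DobrushinDomain} (h : Fires D.carrier (D.pt 0)) {A : Set ℂ}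

include h

/-- A boundary set `A ∌ a` is first met by the chord at parameter `1` (if at all): the chord
meets `∂D` only at its endpoints. [folklore] -/
theorem hitParam_fireChord_eq_one (hA : A ⊆ frontier D.carrier) (ha : D.pt 0 ∉ A) :
    (fireChord D).hitParam A = 1 := by
  refine le_antisymm ((fireChord D).hitParam_mem_Icc A).2
    (le_csInf ⟨1, Curve.one_mem_hitSet _ _⟩ ?_)
  rintro t (⟨ht, hmem⟩ | ht1)
  · rcases (fireChord_mem_frontier_iff h).1 (hA hmem) with h0 | h1
    · exfalso
      apply ha
      rw [h0, ← Curve.source_def, source_fireChord] at hmem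
      exact hmem
    · have := congrArg Subtype.val h1
      simp only [Set.Icc.coe_one] at this
      exact this.ge
  · exact (mem_singleton_iff.1 ht1).ge

/-- A boundary set missing `a` and the landing point `q` is missed by the chord. [folklore] -/
theorem fireChord_notMem (hA : A ⊆ frontier D.carrier) (ha : D.pt 0 ∉ A) (hq : firePt D ∉ A)
    (t : I) : fireChord D t ∉ A := by
  intro hmem
  rcases (fireChord_mem_frontier_iff h).1 (hA hmem) with rfl | rfl
  · rw [← Curve.source_def, source_fireChord] at hmem
    exact ha hmem
  · rw [← Curve.target_def, target_fireChord] at hmem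
    exact hq hmem

/-- **Landing on `A`.** If the chord of a firing domain lands on a closed boundary set `A ∌ a`, the
surgery curve stopped on `A` is a.s. the chord: the stopped law is `[mk chord ∈ T]`. [folklore] -/
theorem fatSurgery_preimage_stopAt_of_mem (hS : S.IsChordal) (hAc : IsClosed A)
    (hA : A ⊆ frontier D.carrier) (ha : D.pt 0 ∉ A) (hq : firePt D ∈ A)
    (T : Set (CurveClass ℂ)) :
    fatSurgery S D (CurveClass.stopAt A ⁻¹' T) = T.indicator 1 (CurveClass.mk (fireChord D)) := by
  have h1 : (fireChord D).hitParam A = 1 := hitParam_fireChord_eq_one h hA ha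
  have hstop : (fireChord D).stopAt A = fireChord D := Curve.stopAt_eq_self_of_hitParam_eq_one h1
  haveI := isProbabilityMeasure_fatSurgery hS D
  refine measure_preimage_stopAt_of_ae_eq ?_ T
  by_cases hqb : firePt D = D.pt 1
  · rw [fatSurgery_of_eq h hqb, ae_dirac_eq, eventually_pure,
      CurveClass.stopAt_mk_holds A hAc, hstop]
  · rw [fatSurgery_of_ne h hqb]
    refine (ae_map_iff (measurable_firePrefix D).aemeasurable
      ((measurable_stopAt hAc) (measurableSet_singleton _))).2 ?_
    filter_upwards [(hS (fireDom h hqb)).2] with ξ hξ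
    rw [pt_zero_fireDom] at hξ
    obtain ⟨hsrc, -, -⟩ := hξ
    obtain ⟨ξ₀, rfl⟩ := CurveClass.surjective_mk ξ
    rw [CurveClass.source_mk] at hsrc
    have hab : (fireChord D).toContinuousMap 1 = ξ₀.toContinuousMap 0 := by
      show (fireChord D).target = ξ₀.source
      rw [target_fireChord, hsrc]
    have hsg : (Curve.mk (fireChord D).toContinuousMap).hitParam A = (1 : I) := by
      show (fireChord D).hitParam A = ((1 : I) : ℝ)
      rw [h1, Set.Icc.coe_one]
    have hmem : (fireChord D).toContinuousMap 1 ∈ A := by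
      show (fireChord D).target ∈ A
      rwa [target_fireChord]
    rw [firePrefix_mk, mkCM, CurveClass.stopAt_mk_holds A hAc, stopAt_concat_of_hit hab hsg hmem]
    show CurveClass.mk ((fireChord D).stopAt A) = _
    rw [hstop]

omit h in
/-- Off a closed set `A` missed by the chord, stopping on `A` commutes with prefixing by the chord
(for suffixes starting at the landing point). [folklore] -/
theorem stopAt_firePrefix_comm (hAc : IsClosed A) (hCA : ∀ t, fireChord D t ∉ A)
    {ξ : CurveClass ℂ} (hξ : ξ.source = firePt D) :
    CurveClass.stopAt A (firePrefix D ξ) = firePrefix D (CurveClass.stopAt A ξ) := by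
  obtain ⟨ξ₀, rfl⟩ := CurveClass.surjective_mk ξ
  rw [CurveClass.source_mk] at hξ
  have hab : (fireChord D).toContinuousMap 1 = ξ₀.toContinuousMap 0 := by
    show (fireChord D).target = ξ₀.source
    rw [target_fireChord, hξ]
  rw [firePrefix_mk, stopAt_concat_of_forall_notMem hab hAc (fun t => hCA t)]
  rfl

omit h in
/-- **Landing off `A`.** If the chord lands off the closed boundary set `A ∌ a` (and off `b`), the
surgery law stopped on `A` is the `S`-law of the crosscut domain stopped on `A`, pulled back along
the prefixing map. [folklore] -/
theorem fatSurgery_preimage_stopAt_of_notMem (hS : S.IsChordal) (h : Fires D.carrier (D.pt 0))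
    (hAc : IsClosed A) (hA : A ⊆ frontier D.carrier) (ha : D.pt 0 ∉ A) (hq : firePt D ∉ A)
    (hqb : firePt D ≠ D.pt 1) {T : Set (CurveClass ℂ)} (hT : MeasurableSet T) :
    fatSurgery S D (CurveClass.stopAt A ⁻¹' T) =
      S (fireDom h hqb) (CurveClass.stopAt A ⁻¹' (firePrefix D ⁻¹' T)) := by
  rw [fatSurgery_of_ne h hqb, map_apply_preimage_stopAt (measurable_firePrefix D) hAc hT]
  refine measure_congr (Filter.eventuallyEq_set.2 ?_)
  filter_upwards [(hS (fireDom h hqb)).2] with ξ hξ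
  rw [pt_zero_fireDom] at hξ
  rw [mem_preimage, mem_preimage, mem_preimage, mem_preimage,
    stopAt_firePrefix_comm hAc (fireChord_notMem h hA ha hq) hξ.1]

end Chord

/-! ### The two crosscut domains of a `3`-marked firing domain with `q ∉ [b, b']` coincide -/

section Three

variable (D : MarkedDomain 3)
  (h₁ : Fires (D.chord 0 1 (by decide)).carrier ((D.chord 0 1 (by decide)).pt 0))
  (hq₁ : firePt (D.chord 0 1 (by decide)) ≠ (D.chord 0 1 (by decide)).pt 1)
  (hq : firePt (D.chord 0 1 (by decide)) ∉ D.arc 1)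

include hq

/-- If the landing point misses `A = [b, b']`, the arc `A` lies in the boundary arc of `∂D` through
`b` cut off by the chord (it is connected, misses `a` and `q`, and contains `b`). [folklore] -/
theorem arc_one_subset_bArc : D.arc 1 ⊆ bArc (isCrosscut_fireChord h₁) hq₁ := by
  have hL := isCrosscut_fireChord h₁
  have hApre : IsPreconnected (D.arc 1) :=
    isPreconnected_Icc.image _ D.continuous_boundary.continuousOn
  have hcover : D.arc 1 ⊆ bArc hL hq₁ ∪ otherArc hL hq₁ := by
    rw [bArc_union_otherArc]
    exact D.arc_subset_frontier 1
  have hdisj : D.arc 1 ∩ (bArc hL hq₁ ∩ otherArc hL hq₁) = ∅ := by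
    ext z
    simp only [mem_inter_iff, mem_empty_iff_false, iff_false, not_and]
    intro hzA hzb hzo
    rcases bArc_inter_otherArc hL hq₁ ⟨hzb, hzo⟩ with hz | hz
    · rw [hz, MarkedDomain.pt_chord_zero] at hzA
      exact pt_zero_notMem_arc_one D hzA
    · rw [mem_singleton_iff.1 hz] at hzA
      exact hq hzA
  rcases (isPreconnected_iff_subset_of_disjoint_closed.1 hApre) _ _
    (isSimpleArc_bArc hL hq₁).isCompact.isClosed (isSimpleArc_otherArc hL hq₁).isCompact.isClosed
    hcover hdisj with hb | ho
  · exact hb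
  · exact absurd (ho (D.pt_mem_arc_self 1)) (pt_one_notMem_otherArc hL hq₁)

variable (h₂ : Fires (D.chord 0 2 (by decide)).carrier ((D.chord 0 2 (by decide)).pt 0))
  (hq₂ : firePt (D.chord 0 2 (by decide)) ≠ (D.chord 0 2 (by decide)).pt 1)

/-- **Same component.** If the landing point misses `[b, b']`, the crosscut domains towards `b` and
towards `b'` have the same carrier: `b'` lies on the boundary arc through `b`, hence on the
frontier of the `b`-component and off the closure of the other component. [folklore] -/
theorem carrier_fireDom_chord_eq : (fireDom h₂ hq₂).carrier = (fireDom h₁ hq₁).carrier := by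
  have hC : fireChord (D.chord 0 2 (by decide)) = fireChord (D.chord 0 1 (by decide)) :=
    fireChord_congr rfl rfl
  have hL₁ := isCrosscut_fireChord h₁
  have hL₂ := isCrosscut_fireChord h₂
  have hb'A : D.pt 2 ∈ D.arc 1 := D.pt_succ_mem_arc 1
  have hb' : D.pt 2 ∈ bArc hL₁ hq₁ := arc_one_subset_bArc D h₁ hq₁ hq hb'A
  -- a point of the `b'`-component, placed in the split towards `b`
  obtain ⟨z, hz₂⟩ := (isConnected_bComponent hL₂ hq₂).nonempty
  have hz : z ∈ bComponent hL₁ hq₁ ∪ otherComponent hL₁ hq₁ := by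
    rw [union_components]
    have := bComponent_subset hL₂ hq₂ hz₂
    rwa [hC] at this
  rcases hz with hzU | hzV
  · show bComponent hL₂ hq₂ = bComponent hL₁ hq₁
    rw [← connectedComponentIn_eq_bComponent hL₂ hq₂ hz₂,
      ← connectedComponentIn_eq_bComponent hL₁ hq₁ hzU, hC]
    rfl
  · exfalso
    have hUV : bComponent hL₂ hq₂ = otherComponent hL₁ hq₁ := by
      rw [← connectedComponentIn_eq_bComponent hL₂ hq₂ hz₂,
        ← connectedComponentIn_eq_otherComponent hL₁ hq₁ hzV, hC]
      rfl
    have hcl : D.pt 2 ∈ closure (otherComponent hL₁ hq₁) := by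
      rw [← hUV]
      exact frontier_subset_closure (pt_one_mem_frontier_bComponent hL₂ hq₂)
    rw [closure_eq_self_union_frontier, frontier_otherComponent] at hcl
    rcases hcl with hV | hL | hO
    · have hfr := D.pt_mem_frontier 2
      rw [D.isOpen.frontier_eq] at hfr
      exact hfr.2 (otherComponent_subset hL₁ hq₁ hV).1
    · obtain ⟨s, hs⟩ := Curve.mem_range.1 hL
      have hsfr : fireChord (D.chord 0 1 (by decide)) s ∈
          frontier (D.chord 0 1 (by decide)).carrier := by
        rw [hs]
        exact D.pt_mem_frontier 2
      rcases (fireChord_mem_frontier_iff h₁).1 hsfr with rfl | rfl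
      · rw [← Curve.source_def, source_fireChord, MarkedDomain.pt_chord_zero] at hs
        exact absurd (D.pt_injective hs) (by decide)
      · rw [← Curve.target_def, target_fireChord] at hs
        rw [hs] at hq
        exact hq hb'A
    · rcases bArc_inter_otherArc hL₁ hq₁ ⟨hb', hO⟩ with h0 | h0
      · rw [MarkedDomain.pt_chord_zero] at h0
        exact absurd (D.pt_injective h0) (by decide)
      · rw [mem_singleton_iff.1 h0] at hb'A
        exact hq hb'A

/-- **The core of the firing case with `q ∉ [b, b']`.** The `S`-laws of the two crosscut domains
`(E; q, b)` and `(E; q, b')`, stopped on `A = [b, b']`, agree: target independence of `S` on the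
`3`-marked structure `(E; q, b, b')` whose arc `[pt 1, pt 2]` is `A`, transported by restriction
locality. [folklore] -/
theorem measure_stopAt_fireDom_eq {S : ChordalFamily} (hS : IsLocalMarkovChordalFamily S)
    {T : Set (CurveClass ℂ)} (hT : MeasurableSet T) :
    S (fireDom h₁ hq₁) (CurveClass.stopAt (D.arc 1) ⁻¹' T) =
      S (fireDom h₂ hq₂) (CurveClass.stopAt (D.arc 1) ⁻¹' T) := by
  have hcar := carrier_fireDom_chord_eq D h₁ hq₁ hq h₂ hq₂
  have hq12 : firePt (D.chord 0 2 (by decide)) = firePt (D.chord 0 1 (by decide)) :=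
    firePt_congr rfl rfl
  set E := fireDom h₁ hq₁ with hE
  -- the three points `q`, `b`, `b'` of `∂E`
  have hbA : D.pt 1 ∈ D.arc 1 := D.pt_mem_arc_self 1
  have hb'A : D.pt 2 ∈ D.arc 1 := D.pt_succ_mem_arc 1
  have hqfr : firePt (D.chord 0 1 (by decide)) ∈ frontier E.carrier := by
    rw [← pt_zero_fireDom h₁ hq₁]
    exact E.pt_mem_frontier 0
  have hbfr : D.pt 1 ∈ frontier E.carrier := by
    have := E.pt_mem_frontier 1
    rwa [hE, pt_one_fireDom] at this
  have hb'fr : D.pt 2 ∈ frontier E.carrier := by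
    have := (fireDom h₂ hq₂).pt_mem_frontier 1
    rwa [pt_one_fireDom, hcar] at this
  have hqb : firePt (D.chord 0 1 (by decide)) ≠ D.pt 1 := hq₁
  have hqb' : firePt (D.chord 0 1 (by decide)) ≠ D.pt 2 := fun e => hq (by rw [e]; exact hb'A)
  have hbb' : D.pt 1 ≠ D.pt 2 := fun e => absurd (D.pt_injective e) (by decide)
  obtain ⟨M, hMc, hM0, hMq, hM12⟩ :=
    E.toJordanDomain.exists_markedThree hqfr hbfr hb'fr hqb hqb' hbb'
  -- the arc `[pt 1, pt 2]` of `M` is `A`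
  have hApre : IsPreconnected (D.arc 1) :=
    isPreconnected_Icc.image _ D.continuous_boundary.continuousOn
  have hAfrE : D.arc 1 ⊆ frontier M.carrier := by
    rw [hMc]
    refine (arc_one_subset_bArc D h₁ hq₁ hq).trans ?_
    show bArc (isCrosscut_fireChord h₁) hq₁ ⊆ frontier (fireDom h₁ hq₁).carrier
    rw [frontier_fireDom]
    exact subset_union_right
  have hq0 : M.pt 0 ∉ D.arc 1 := by rw [hMq]; exact hq
  -- identification of the laws and target independence of `S` on `M`
  have key := hS.targetIndependent M T hT
  rcases hM12 with ⟨hM1, hM2⟩ | ⟨hM1, hM2⟩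
  · have harc : M.arc 1 = D.arc 1 :=
      M.arc_one_eq_of_mark_zero hM0 (D.isClosed_arc 1) hApre hAfrE hq0 (by rw [hM1]; exact hbA)
        (by rw [hM2]; exact hb'A) (by rw [hM1]; exact D.isPreconnected_arc_one_diff_pt_one)
        (by rw [hM2]; exact D.isPreconnected_arc_one_diff_pt_two)
    rw [harc, eq_of_isLocal_of_carrier_eq hS.isLocal (D₁ := M.chord 0 1 (by decide))
        (D₂ := fireDom h₁ hq₁) hMc (by rw [MarkedDomain.pt_chord_zero, hMq, pt_zero_fireDom])
        (by rw [MarkedDomain.pt_chord_one, hM1, pt_one_fireDom]; rfl),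
      eq_of_isLocal_of_carrier_eq hS.isLocal (D₁ := M.chord 0 2 (by decide))
        (D₂ := fireDom h₂ hq₂) (hMc.trans hcar.symm)
        (by rw [MarkedDomain.pt_chord_zero, hMq, pt_zero_fireDom, hq12])
        (by rw [MarkedDomain.pt_chord_one, hM2, pt_one_fireDom]; rfl)] at key
    exact key
  · have harc : M.arc 1 = D.arc 1 :=
      M.arc_one_eq_of_mark_zero hM0 (D.isClosed_arc 1) hApre hAfrE hq0 (by rw [hM1]; exact hb'A)
        (by rw [hM2]; exact hbA) (by rw [hM1]; exact D.isPreconnected_arc_one_diff_pt_two)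
        (by rw [hM2]; exact D.isPreconnected_arc_one_diff_pt_one)
    rw [harc, eq_of_isLocal_of_carrier_eq hS.isLocal (D₁ := M.chord 0 1 (by decide))
        (D₂ := fireDom h₂ hq₂) (hMc.trans hcar.symm)
        (by rw [MarkedDomain.pt_chord_zero, hMq, pt_zero_fireDom, hq12])
        (by rw [MarkedDomain.pt_chord_one, hM1, pt_one_fireDom]; rfl),
      eq_of_isLocal_of_carrier_eq hS.isLocal (D₁ := M.chord 0 2 (by decide))
        (D₂ := fireDom h₁ hq₁) hMc (by rw [MarkedDomain.pt_chord_zero, hMq, pt_zero_fireDom])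
        (by rw [MarkedDomain.pt_chord_one, hM2, pt_one_fireDom]; rfl)] at key
    exact key.symm

end Three

/-! ### Target independence of the fat surgery -/

/-- **The fat surgery of an admissible family is target independent.** [folklore] -/
theorem isTargetIndependent_fatSurgery {S : ChordalFamily} (hS : IsLocalMarkovChordalFamily S) :
    (fatSurgery S).IsTargetIndependent := by
  intro D T hT
  have hAc : IsClosed (D.arc 1) := D.isClosed_arc 1
  have hAfr : D.arc 1 ⊆ frontier D.carrier := D.arc_subset_frontier 1
  have ha : D.pt 0 ∉ D.arc 1 := pt_zero_notMem_arc_one D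
  have hb : D.pt 1 ∈ D.arc 1 := D.pt_mem_arc_self 1
  have hb' : D.pt 2 ∈ D.arc 1 := D.pt_succ_mem_arc 1
  by_cases h₁ : Fires (D.chord 0 1 (by decide)).carrier ((D.chord 0 1 (by decide)).pt 0)
  · have h₂ : Fires (D.chord 0 2 (by decide)).carrier ((D.chord 0 2 (by decide)).pt 0) := h₁
    have hC : fireChord (D.chord 0 2 (by decide)) = fireChord (D.chord 0 1 (by decide)) :=
      fireChord_congr rfl rfl
    have hq12 : firePt (D.chord 0 2 (by decide)) = firePt (D.chord 0 1 (by decide)) :=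
      firePt_congr rfl rfl
    by_cases hq : firePt (D.chord 0 1 (by decide)) ∈ D.arc 1
    · have hq' : firePt (D.chord 0 2 (by decide)) ∈ D.arc 1 := by rwa [hq12]
      rw [fatSurgery_preimage_stopAt_of_mem h₁ hS.isChordal hAc hAfr ha hq T,
        fatSurgery_preimage_stopAt_of_mem h₂ hS.isChordal hAc hAfr ha hq' T, hC]
    · have hq' : firePt (D.chord 0 2 (by decide)) ∉ D.arc 1 := by rwa [hq12]
      have hq₁ : firePt (D.chord 0 1 (by decide)) ≠ (D.chord 0 1 (by decide)).pt 1 :=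
        fun e => hq (by rw [e]; exact hb)
      have hq₂ : firePt (D.chord 0 2 (by decide)) ≠ (D.chord 0 2 (by decide)).pt 1 :=
        fun e => hq' (by rw [e]; exact hb')
      rw [fatSurgery_preimage_stopAt_of_notMem hS.isChordal h₁ hAc hAfr ha hq hq₁ hT,
        fatSurgery_preimage_stopAt_of_notMem hS.isChordal h₂ hAc hAfr ha hq' hq₂ hT,
        firePrefix_congr (D := D.chord 0 2 (by decide)) (D' := D.chord 0 1 (by decide)) rfl rfl]
      exact measure_stopAt_fireDom_eq D h₁ hq₁ hq h₂ hq₂ hS (hT.preimage (measurable_firePrefix _))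
  · have h₂ : ¬ Fires (D.chord 0 2 (by decide)).carrier ((D.chord 0 2 (by decide)).pt 0) := h₁
    rw [fatSurgery_of_not_fires h₁, fatSurgery_of_not_fires h₂]
    exact hS.targetIndependent D T hT

end FatSurgeryTI

open FatSurgeryTI in
/-- **S7f.4 (`stub_fatSurgeryTI`).** The fat surgery of an admissible family is target independent
(locality, splitting form; LSW 2001 Cor. 2.3, Werner 2007 Prop. 3.4). [folklore] -/
theorem stub_fatSurgeryTI : ∀ S : ChordalFamily, IsLocalMarkovChordalFamily S → (Summit.CriticalPhenomena.CardyFormulaZ2.Theorems.CardyRotToConfR2SymmetryUpgrade.Negative.fatSurgery S).IsTargetIndependent :=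
  fun _ hS => isTargetIndependent_fatSurgery hS

end Summit.CriticalPhenomena.CardyFormulaZ2.Theorems.CardyRotToConfR2SymmetryUpgrade

end
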